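import Mathlib
import HarnessLib
import Summits.HubbardSuperconductivity.HubbardSuperconductivity.Theorems.KLProgrammeKLRegimeEngineNearCoefficientRegime
import Summits.HubbardSuperconductivity.HubbardSuperconductivity.Theorems.KLProgrammeKLRegimeEngineIsoBoxNearFar

/-!
# Route `KLProgramme` — ENGINE item stmt-HubbardSuperconductivity-20437, class #6 / (E5-F)ₙ producer, route (M): THE M3 SHAPE IN THE KL REGIME —
# `fixedTupleL1 β 3 (klIsoKernelAt … K n m) Ω x₁ ≤ (C(ρ+Λ_m)³)³·(B/24 + (Λ_m + π/β)·3·Mom) + 3·Mom·Λ_m/ρ` from the (E5-F) value bound `B` on `klBall L μ 0` and the moments `Mom`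

Cell gate-hubbard-kl, seat hubbard-kl-k3c2-p2 (g11; owner-designate of M1 + M3 of route (M), pen (R59az)).  Composition of this lineage's M3 shape fed by an (E5-F)-type value hypothesis
(`fixedTupleL1_klIsoKernelAt_le_of_ballValue_moments_counts`, …EngineIsoBoxNearFar §4, p575176) with the scale-free near coefficient of the KL regime
(`near_coefficient_klIso_le_of_thresholds`, …EngineNearCoefficientRegime): the frame smallness needed for the ball inclusion (`|K(p_k⃗)| ≤ A`, `Λ_m + A ≤ klE0` for `m ≥ 1`) is read off
`FrameOK` in the regime exactly as the frame `C²` size (`norm_iteratedFDeriv_frameShift_le_of_frameOK_regime`, `abs_frameShift_toLp_le`).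

* **`fixedTupleL1_klIsoKernelAt_le_regime`** — `∃ C > 0` absolute: for every admissible `(R, c, U, β, μ, K)`, `L ≥ β²`, `β ≤ M`, every kernel scale `n`, resolution `1 ≤ m ≤ n_β`,
  BGM-ordered iso tuple `Ω` with spins `(0,0,1,1)`, pin `x₁`, `ρ > 0`, value bound `B ≥ 0` on `klBall L μ 0` (the (E5-F)ₙ hypothesis at frame `K`) and moment bound `Mom`:
  `fixedTupleL1 β 3 (klIsoKernelAt … K n m) Ω x₁ ≤ (C·(ρ + Λ_m)³)³·(B/24 + (Λ_m + π/β)·(3·Mom)) + 3·Mom·Λ_m/ρ`.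

What M3 proper adds at T+: `K := K_n = klFlowFrameU … n` (admissible by the tower's `FrameOK`), `Mom` from (E4-iso)ₙ (M2), the choice of `ρ`, the other spin/charge orders
(`fixedTupleL1_klIsoKernelAt_comp_perm`, `…_eq_zero_of_charge/_spin`, spin flip, SU(2) for equal spins), `m ≥ n_β + 1` (empty support on the Matsubara grid), and the door.
Everything is proved; no definitions; nothing about the model is asserted.  References: BGM 2006 §2.7 (2.69)–(2.71a) [cite: BenfattoGiulianiMastropietro2006].
-/

noncomputable section

namespace Summit.HubbardSuperconductivity.HubbardSuperconductivity.Theorems.EngineV8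

set_option linter.dupNamespace false -- summit = problem name (single-conjunct summit), D-0017

open Set Finset Literature.MathematicalPhysics.QuantumLattice Literature.MathematicalPhysics.QuantumLattice.BandSectorCounting
open Literature.MathematicalPhysics.QuantumLattice.FermiRG Literature.Probability.LatticeModels Literature.Analysis.SpecialFunctions
open Summit.HubbardSuperconductivity.HubbardSuperconductivity.Theorems.DispersionFlow
open Summit.HubbardSuperconductivity.HubbardSuperconductivity.Theorems.KLRegimeSplit
open Summit.HubbardSuperconductivity.HubbardSuperconductivity.Theorems.KLProgrammeLegKernels
open Summit.HubbardSuperconductivity.HubbardSuperconductivity.Theorems.PerturbedFermiCurve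
open Summit.HubbardSuperconductivity.HubbardSuperconductivity.Theorems.TorusFourierL2
open scoped Real

section Regime

open Classical

/-- In the KL regime the frame is uniformly small on the torus: `|K(p_k⃗)| ≤ 2·Gfr 0·|U| + 2·Gfr 1·U² + Gfr 2·c/log 4`. -/
theorem abs_eval_latticeMomentum_le_of_frameOK_regime {L : ℕ} {R : RenConsts} (hR : ∀ j, 0 ≤ R.Gfr j) {c U β μ : ℝ}
    (hc : 0 ≤ c) (hβmin : klBetaMin ≤ β) (hβc : β ≤ Real.exp (c / U ^ 2)) {K : TrigPolyC4v} (hK : FrameOK R U (nScales β) μ K) (k : TorusSite 2 L) :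
    |K.eval (latticeMomentum L k)| ≤ 2 * R.Gfr 0 * |U| + 2 * R.Gfr 1 * U ^ 2 + R.Gfr 2 * (c / Real.log 4) := by
  have hA : ∀ p : Momentum, ∀ j ≤ 2, ‖iteratedFDeriv ℝ j (frameShift K) p‖ ≤ 2 * R.Gfr 0 * |U| + 2 * R.Gfr 1 * U ^ 2 + R.Gfr 2 * (c / Real.log 4) :=
    fun p j hj => norm_iteratedFDeriv_frameShift_le_of_frameOK_regime hR hc hβmin hβc hK p hj
  have h := abs_frameShift_toLp_le hA (latticeMomentum L k)
  rw [frameShift] at h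
  simpa using h

/-- **THE M3 SHAPE IN THE KL REGIME** (see the module docstring). -/
theorem fixedTupleL1_klIsoKernelAt_le_regime (ha : (-4 : ℝ) < -(6 / 5)) (hab : (-(6 / 5) : ℝ) ≤ -(1 / 10)) (hb : (-(1 / 10) : ℝ) < 0) :
    ∃ C : ℝ, 0 < C ∧ ∀ (R : RenConsts), (∀ j, 0 ≤ R.Gfr j) →
      ∀ (c U : ℝ), 0 < c →
      c ≤ min (min ((bandBounds ha hab hb).Dtmin / 4) ((bandBounds ha hab hb).rhomin / 4)) (1 / 40) / (12 * (R.Gfr 2 + 1)) → 0 < U →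
      U ≤ min 1 (min (min ((bandBounds ha hab hb).Dtmin / 4) ((bandBounds ha hab hb).rhomin / 4)) (1 / 40) / (24 * (R.Gfr 0 + R.Gfr 1 + 1))) →
      ∀ β : ℝ, klBetaMin ≤ β → β ≤ Real.exp (c / U ^ 2) → ∀ μ ∈ klWindowC, ∀ K : TrigPolyC4v, FrameOK R U (nScales β) μ K →
      ∀ (L M : ℕ) [NeZero L] [NeZero M], β ^ 2 ≤ (L : ℝ) → β ≤ (M : ℝ) → ∀ (n m : ℕ), 1 ≤ m → m ≤ nScales β →
      ∀ (Ω : Fin 4 → SectorLeg (sectorCount (2 * m))), (Ω 0).2 = 0 → (Ω 1).2 = 1 → (Ω 2).2 = 0 → (Ω 3).2 = 1 →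
        (Ω 0).1.2 = 0 → (Ω 1).1.2 = 0 → (Ω 2).1.2 = 1 → (Ω 3).1.2 = 1 →
      ∀ (x₁ : SpaceTimeIdx L M) (ρ B Mom : ℝ), 0 < ρ → 0 ≤ B →
        (∀ k₁ ∈ klBall L μ 0, ∀ k₂ ∈ klBall L μ 0, ∀ k₃ ∈ klBall L μ 0, ‖klQuarticValue L M β U μ K n 0 1 k₁ k₂ k₃‖ ≤ B) →
        (∀ j : Fin 3, imagTimeWeight β M ^ 3 * ∑ y : Fin 3 → SpaceTimeIdx L M,
          spaceTimeDist L M β x₁ (y j) * ‖klIsoKernelAt L M β U μ K n m Ω (Matrix.vecCons x₁ y)‖ ≤ Mom) →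
        fixedTupleL1 L M β 3 (klIsoKernelAt L M β U μ K n m) Ω x₁ ≤
          (C * (ρ + klScale klE0 m) ^ 3) ^ 3 * (B / 24 + (klScale klE0 m + π / β) * (3 * Mom)) + 3 * Mom * klScale klE0 m / ρ := by
  obtain ⟨C, hC, hnear⟩ := near_coefficient_klIso_le_of_thresholds ha hab hb
  refine ⟨C, hC, ?_⟩
  intro R hR c U hc hcle hU hUle β hβmin hβc μ hμ K hK L M _ _ hLβ hβM n m hm1 hmN Ω h0 h1 h2 h3 hs0 hs1 hs2 hs3 x₁ ρ B Mom hρ hB0 hB hMom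
  set Bb : BandBounds (-(6 / 5)) (-(1 / 10)) := bandBounds ha hab hb with hBdef
  set κ₀ : ℝ := min (min (Bb.Dtmin / 4) (Bb.rhomin / 4)) (1 / 40) with hκ₀
  have hκ₀pos : 0 < κ₀ := by
    rw [hκ₀]; have := Bb.Dtmin_pos; have := Bb.rhomin_pos
    exact lt_min (lt_min (by positivity) (by positivity)) (by norm_num)
  have hκ₀40 : κ₀ ≤ 1 / 40 := min_le_right _ _
  have hβ0 : 0 < β := pos_of_klBetaMin_le hβmin
  have he : (0 : ℝ) < klE0 := by norm_num [klE0]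
  set Λ : ℝ := klScale klE0 m with hΛdef
  have hΛ0 : 0 < Λ := klth_klScale_pos m
  -- the frame is small on the torus: `|K(p_k)| ≤ κ₀/4`
  have hlog : 1 ≤ Real.log 4 := by
    have h4 : Real.exp 1 ≤ 4 := by have := Real.exp_one_lt_d9; norm_num at this; linarith
    calc (1 : ℝ) = Real.log (Real.exp 1) := (Real.log_exp 1).symm
      _ ≤ Real.log 4 := Real.log_le_log (Real.exp_pos 1) h4
  have hKev : ∀ k : TorusSite 2 L, |K.eval (latticeMomentum L k)| ≤ κ₀ / 4 := by
    intro k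
    refine (abs_eval_latticeMomentum_le_of_frameOK_regime hR hc.le hβmin hβc hK k).trans ?_
    have h0' := hR 0; have h1' := hR 1; have h2' := hR 2
    have hU1 : U ≤ 1 := hUle.trans (min_le_left _ _)
    have hUk : U ≤ κ₀ / (24 * (R.Gfr 0 + R.Gfr 1 + 1)) := hUle.trans (min_le_right _ _)
    rw [abs_of_pos hU]
    have hU2 : U ^ 2 ≤ U := by nlinarith only [hU, hU1]
    have hA1 : 2 * R.Gfr 0 * U + 2 * R.Gfr 1 * U ^ 2 ≤ 2 * (R.Gfr 0 + R.Gfr 1 + 1) * U := by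
      have := mul_le_mul_of_nonneg_left hU2 h1'
      linarith only [this, hU.le]
    have hB1 : 2 * (R.Gfr 0 + R.Gfr 1 + 1) * U ≤ κ₀ / 12 := by
      have hpos : 0 < 24 * (R.Gfr 0 + R.Gfr 1 + 1) := by positivity
      have := (le_div_iff₀ hpos).mp hUk
      linarith only [this]
    have hC1 : R.Gfr 2 * (c / Real.log 4) ≤ R.Gfr 2 * c := mul_le_mul_of_nonneg_left (div_le_self hc.le hlog) h2'
    have hD1 : R.Gfr 2 * c ≤ κ₀ / 12 := by
      have hpos : 0 < 12 * (R.Gfr 2 + 1) := by positivity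
      have := (le_div_iff₀ hpos).mp hcle
      linarith only [this, hc.le]
    linarith only [hA1, hB1, hC1, hD1, hκ₀pos]
  -- `Λ_m + κ₀/4 ≤ klE0` for `m ≥ 1`
  have hΛA : klScale klE0 m + κ₀ / 4 ≤ klE0 := by
    have hΛ1 : klScale klE0 m ≤ klScale klE0 1 := by
      unfold klScale; exact mul_le_mul_of_nonneg_left (inv_anti₀ (by positivity) (pow_le_pow_right₀ (by norm_num) hm1)) he.le
    have e1 : klScale klE0 1 = klE0 / 4 := by unfold klScale; ring
    have he0 : klE0 = 1 / 32 := rfl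
    rw [e1] at hΛ1
    rw [he0] at hΛ1 ⊢
    linarith only [hΛ1, hκ₀40]
  -- the M3 shape with the actual counts
  have hR0 : 0 < ρ / Λ := div_pos hρ hΛ0
  have hshape := fixedTupleL1_klIsoKernelAt_le_of_ballValue_moments_counts hβ0 U μ K hKev n m hΛA Ω h0 h1 h2 h3 hs0 hs1 hs2 hs3 x₁
    (NR := ((((univ : Finset (SpaceTimeIdx L M)).filter fun y => spaceTimeDist L M β x₁ y < ρ / Λ).card : ℕ) : ℝ)) hR0 hB0 hB hMom le_rfl
  -- the near coefficient
  have hcoef := hnear R hR c U hc hcle hU hUle β hβmin hβc μ hμ K hK L M hLβ hβM m hmN Ω x₁ ρ hρ.le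
  rw [← hΛdef] at hcoef
  have hL0 : (0 : ℝ) < L := Nat.cast_pos.2 (NeZero.pos L)
  have hβL : 0 < (β * (L : ℝ) ^ 2) ^ 3 := by positivity
  have hMom0 : 0 ≤ Mom := le_trans (mul_nonneg (pow_nonneg (imagTimeWeight_nonneg hβ0.le M) 3) (sum_nonneg fun y _ =>
    mul_nonneg (by unfold KLRegimeSplit.spaceTimeDist; exact le_max_of_le_right (le_max_of_le_left (Nat.cast_nonneg _))) (norm_nonneg _))) (hMom 0)
  have hX0 : 0 ≤ B / 24 + (Λ + π / β) * (3 * Mom) := by positivity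
  refine hshape.trans ?_
  rw [← hΛdef]
  -- regroup the near term as (coefficient) × (B/24 + …) and the far term as `3·Mom·Λ/ρ`
  have e1 : imagTimeWeight β M ^ 3 *
        ((((univ : Finset (SpaceTimeIdx L M)).filter fun y => spaceTimeDist L M β x₁ y < ρ / Λ).card : ℕ) : ℝ) ^ 3 *
          ((∏ j : Fin 3, ((((univ : Finset (FreqMomentum L M)).filter fun q => klIsoFamily L M β μ K klE0 m (Ω j.succ).1.1 q ≠ 0).card : ℕ) : ℝ)) *
            ((B / 24 + (Λ + π / β) * (3 * Mom)) / (β * (L : ℝ) ^ 2) ^ 3)) =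
      (imagTimeWeight β M ^ 3 *
          ((((univ : Finset (SpaceTimeIdx L M)).filter fun y => spaceTimeDist L M β x₁ y < ρ / Λ).card : ℕ) : ℝ) ^ 3 *
            (∏ j : Fin 3, ((((univ : Finset (FreqMomentum L M)).filter fun q => klIsoFamily L M β μ K klE0 m (Ω j.succ).1.1 q ≠ 0).card : ℕ) : ℝ)) /
          (β * (L : ℝ) ^ 2) ^ 3) * (B / 24 + (Λ + π / β) * (3 * Mom)) := by
    rw [div_eq_mul_inv, div_eq_mul_inv _ ((β * (L : ℝ) ^ 2) ^ 3)]
    ring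
  have e2 : 3 * Mom / (ρ / Λ) = 3 * Mom * Λ / ρ := div_div_eq_mul_div (3 * Mom) ρ Λ
  rw [e1, e2]
  exact add_le_add (mul_le_mul_of_nonneg_right hcoef hX0) le_rfl

end Regime

end Summit.HubbardSuperconductivity.HubbardSuperconductivity.Theorems.EngineV8

end
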